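import Summits.BirchSwinnertonDyer.BirchSwinnertonDyer.Theorems.KolyvaginRankRigidityAtTwoOffHabitatIrredInflationDefectSah
import Literature.NumberTheory.EllipticCurves.SerreAdicOpenImageCongruence
import Literature.NumberTheory.EllipticCurves.TateModuleProjSurjectiveProofs
import Literature.NumberTheory.GaloisRepresentations.ArtinFormalismInductionProofs
import HarnessLib

/-!
# Route `KolyvaginRankRigidityAtTwo`, residual crux R_irr `OffHabitatIrredNonSurjTwoConverse`
# (stmt-BirchSwinnertonDyer-27123, LINE 8 «margin absorbs index»): the INFLATION DEFECT IS
# BOUNDED UNIFORMLY IN THE LEVEL at finite `2`-adic index — from Serre's open image theorem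
# (helper, PROVED modulo the named fact `serre_adicImage_contains_congruenceSubgroup`;
# width seat `bsd-line-krr2-p2` g9)

Item 27123's `why it might fail`: «the finite-index defect of the Čebotarev eigenvector lemma /
`H¹(K(E[2^M])/K, E[2^M])` must be BOUNDED in `M` for fixed `E`». This file discharges that bet from
the ONE print input it needs, in the currency of the finite-index Čebotarev theorem
(`exists_kolyvaginPrime_gt_two_eigenclass_of_inflationDefect`, hypothesis `hSah`):

* `exists_smul_eq_natCast_smul_of_serre` — Serre's `2`-adic open image theorem in congruence form
  (tree named fact `serre_adicImage_contains_congruenceSubgroup`, Silverman AEC Thm. III.7.9 (a))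
  gives, for non-CM `E/ℚ`, ONE `σ ∈ Γ_ℚ` acting on EVERY `E(ℚ̄)[2^M]` as the scalar `1 + 2^{n+2}`
  (realise the homothety `1 + 2^{n+2} ∈ 1 + 2^n M₂(ℤ₂)` on `T_2E`, read it on `E[2^M]` through the
  surjective projections `T_2E → E[2^M]`, `proj_surjective_of_isAlgClosed_holds`);
* `exists_smul_eq_mul_self_zsmul_baseChange` — for `[K:ℚ] = 2`, `σ² ∈ Γ_K` (index `2`), acting on
  `E(K̄)[2^M]` as `(1 + 2^{n+2})²` (transport `RatClosure.torsionEquiv`);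
* `pow_zsmul_eq_zero_of_mul_odd_zsmul_eq_zero` — odd factors are harmless on `2`-primary classes;
* `inflationDefect_of_serre` — **∃ k (= n + 3), ∀ M ≤ M', every `x ∈ H¹(K, E[2^M])` vanishing on
  `Γ_{K(E[2^{M'}])}` has `2^k x = 0`**, for non-CM `E/ℚ` and quadratic `K`, by the general-scalar
  Sah lemma `sub_one_zsmul_eq_zero_of_h1Eval_eq_zero_of_smul_eq` (`(1 + 2^{n+2})² - 1 =
  2^{n+3}(1 + 2^{n+1})`). No surjectivity, any (finite) `2`-adic index; uniform in `M, M'`.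

HONEST FRAMING: helper lemmas (`--supports` 27123), CONDITIONAL on the named fact
`serre_adicImage_contains_congruenceSubgroup` (Serre 1968/1972, in print; not proved in the tree).
Nothing here closes R_irr, U1 28083 or the print item 23091; BSD is NOT proved by any of this.

References: [SilvermanAEC2009] Thm. III.7.9 (a), III.§7; [Serre1972] §4; [Sah1968] Prop. 2.7 (b);
[Kolyvagin1991MathAnn] §2 (finite index); [RouseZureickBrown2015]; [GrossLMS1991] §9.
-/

set_option autoImplicit false
-- the Theorems namespace of this sub repeats the summit name by design (D-0017 nested layout)
set_option linter.dupNamespace false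

noncomputable section

open scoped Classical

namespace Summit.BirchSwinnertonDyer.BirchSwinnertonDyer.Theorems.KolyvaginLowerBoundAtTwo

open WeierstrassCurve Field
open Literature.NumberTheory.GaloisRepresentations Literature.NumberTheory.EllipticCurves
open Literature.NumberTheory Literature

universe u

/-! ### One homothety of `T_2E` in the image, read on every `E[2^M]` -/

/-- **Serre's open image theorem supplies a scalar**: for non-CM `E/ℚ` there are `n` and ONE
`σ ∈ Γ_ℚ` acting on every `E(ℚ̄)[2^M]` as multiplication by `1 + 2^{n+2}` (the homothety
`1 + 2^{n+2}` of `T_2E` is `≡ 1 (mod 2^n)`, hence in the image; its `M`-th component is the scalar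
on `E[2^M]`, every point of which lifts to `T_2E`). Conditional on the named fact
`serre_adicImage_contains_congruenceSubgroup`. [cite: SilvermanAEC2009, Thm. III.7.9 (a), III.§7] -/
theorem exists_smul_eq_natCast_smul_of_serre (hSerre : serre_adicImage_contains_congruenceSubgroup)
    (W : WeierstrassCurve ℚ) [W.IsElliptic] (hCM : ¬ W.HasCM) :
    ∃ (n : ℕ) (σ : absoluteGaloisGroup ℚ), ∀ (M : ℕ) (P : geomTorsion W ((2 ^ M : ℕ) : ℤ)),
      σ • P = ((1 + 2 ^ (n + 2) : ℕ) : ℤ) • P := by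
  haveI : Fact (Nat.Prime 2) := ⟨Nat.prime_two⟩
  obtain ⟨n, hn⟩ := hSerre W 2 hCM
  -- the unit `u = 1 + 2^{n+2}` of `ℤ₂`
  have hmem : -((2 : ℤ_[2]) ^ (n + 2)) ∈ nonunits ℤ_[2] := by
    rw [← IsLocalRing.mem_maximalIdeal, PadicInt.maximalIdeal_eq_span_p, Ideal.mem_span_singleton]
    exact (dvd_pow_self _ (by omega)).neg_right
  have hu : IsUnit (1 + (2 : ℤ_[2]) ^ (n + 2)) := by
    have := IsLocalRing.isUnit_one_sub_self_of_mem_nonunits _ hmem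
    rwa [sub_neg_eq_add] at this
  set u : ℤ_[2]ˣ := hu.unit with hu_def
  have hu_val : (u : ℤ_[2]) = 1 + (2 : ℤ_[2]) ^ (n + 2) := hu.unit_spec
  -- the homothety `u` on `T_2E` is `≡ 1 (mod 2^n)`
  set U : W.tateModule 2 ≃ₗ[ℤ_[2]] W.tateModule 2 := LinearEquiv.smulOfUnit u with hU
  have hU_apply : ∀ a : W.tateModule 2, U a = (u : ℤ_[2]) • a := fun a ↦ by
    rw [hU, LinearEquiv.smulOfUnit, DistribMulAction.toLinearEquiv_apply, Units.smul_def]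
  have hcong : ∀ a : W.tateModule 2, ∃ y : W.tateModule 2, U a - a = ((2 : ℤ_[2]) ^ n) • y := by
    intro a
    refine ⟨((2 : ℤ_[2]) ^ 2) • a, ?_⟩
    rw [hU_apply, hu_val, add_smul, one_smul, add_sub_cancel_left, smul_smul, ← pow_add]
  obtain ⟨σ, hσ⟩ := hn U hcong
  refine ⟨n, σ, fun M P ↦ ?_⟩
  -- lift `P` to `T_2E` and read the `M`-th component
  obtain ⟨a, ha⟩ := proj_surjective_of_isAlgClosed_holds W 2 M P.2
  have h1 : σ • (TateModule.proj 2 M a) = TateModule.proj 2 M (σ • a) :=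
    (TateModule.proj_smul_of_distribMulAction σ a M).symm
  have h2 : σ • a = (u : ℤ_[2]) • a := by
    have := congrArg (fun f : W.tateModule 2 →ₗ[ℤ_[2]] W.tateModule 2 ↦ f a) hσ
    simp only [LinearEquiv.coe_coe] at this
    rw [galoisRepTate_apply_apply, hU_apply] at this
    exact this
  have h3 : TateModule.proj 2 M ((u : ℤ_[2]) • a) =
      (PadicInt.toZModPow M (u : ℤ_[2])).val • TateModule.proj 2 M a :=
    TateModule.proj_smul _ a M
  have h4 : (PadicInt.toZModPow M (u : ℤ_[2])).val = (1 + 2 ^ (n + 2)) % 2 ^ M := by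
    rw [hu_val, show (1 + (2 : ℤ_[2]) ^ (n + 2)) = ((1 + 2 ^ (n + 2) : ℕ) : ℤ_[2]) by push_cast; ring,
      map_natCast, ZMod.val_natCast]
  -- `(c % 2^M) • P = c • P` since `2^M P = 0`
  have hkill : (2 ^ M : ℕ) • (P : geomPoints W) = 0 := by
    have := (mem_geomTorsion_iff W _ (P : geomPoints W)).mp P.2
    rwa [natCast_zsmul] at this
  apply Subtype.ext
  rw [AddSubgroup.torsionBy.coe_smul, AddSubgroupClass.coe_zsmul, ← ha, h1, h2, h3, h4, ha,
    natCast_zsmul]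
  conv_rhs => rw [← Nat.mod_add_div (1 + 2 ^ (n + 2)) (2 ^ M), add_nsmul, mul_nsmul, hkill,
    smul_zero, add_zero]

/-! ### From `Γ_ℚ` to `Γ_K`: squares -/

/-- **A scalar in `ρ(Γ_ℚ)` gives its square in `ρ(Γ_K)`** (`[K:ℚ] = 2`): if `γ ∈ Γ_ℚ` acts on
`E(ℚ̄)[n]` as the integer `u`, some `g ∈ Γ_K` acts on `E(K̄)[n]` as `u·u` (`γ² ∈ res Γ_K`, index
`2`; transport along `RatClosure.torsionEquiv`). [cite: GrossLMS1991, §9 (before Prop. 9.1)] -/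
theorem exists_smul_eq_mul_self_zsmul_baseChange (W : WeierstrassCurve ℚ) {K : Type u} [Field K]
    [NumberField K] (hK : Module.finrank ℚ K = 2) {n : ℤ} {γ : absoluteGaloisGroup ℚ} {u : ℤ}
    (hγ : ∀ P : geomTorsion W n, γ • P = u • P) :
    ∃ g : absoluteGaloisGroup K, ∀ Q : geomTorsion (W.baseChange K) n, g • Q = (u * u) • Q := by
  set θ := RatClosure.torsionEquiv (K := K) W n with hθ
  set H := (absGaloisRestrict ℚ K).range with hH
  have hHi : H.index = 2 := (index_range_absGaloisRestrict_eq_finrank ℚ K).trans hK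
  haveI : H.Normal := Subgroup.normal_of_index_eq_two hHi
  haveI : H.FiniteIndex := ⟨by rw [hHi]; decide⟩
  obtain ⟨g, hg⟩ : γ ^ 2 ∈ H := by
    have := Subgroup.pow_index_mem H γ
    rwa [hHi] at this
  refine ⟨g, fun Q ↦ ?_⟩
  obtain ⟨P, rfl⟩ := θ.surjective Q
  change (absGaloisRestrict ℚ K) g = γ ^ 2 at hg
  rw [← RatClosure.torsionEquiv_smul, hg, pow_two, mul_smul, hγ, hγ, smul_smul, map_zsmul]

/-! ### Odd factors are harmless on `2`-primary classes -/

/-- If `(2^a (2d+1)) x = 0` and `2^M x = 0` in an abelian group, then `2^a x = 0`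
(`y = 2^a x` satisfies `y = (-2d) y`, hence `y = (-2d)^M y = ±d^M 2^M y = 0`). [folklore] -/
theorem pow_zsmul_eq_zero_of_mul_odd_zsmul_eq_zero {A : Type*} [AddCommGroup A] {x : A}
    {a d M : ℕ} (h : ((2 : ℤ) ^ a * (2 * d + 1)) • x = 0) (hM : (2 : ℤ) ^ M • x = 0) :
    (2 : ℤ) ^ a • x = 0 := by
  set y := (2 : ℤ) ^ a • x with hy
  have hy1 : y = (-(2 * (d : ℤ))) • y := by
    have h' : (2 * (d : ℤ) + 1) • y = 0 := by rw [hy, smul_smul, mul_comm, h]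
    rw [add_zsmul, one_zsmul] at h'
    rw [neg_zsmul]
    exact eq_neg_of_add_eq_zero_right h'
  have hyj : ∀ j : ℕ, y = (-(2 * (d : ℤ))) ^ j • y := by
    intro j
    induction j with
    | zero => rw [pow_zero, one_zsmul]
    | succ j ih => rw [pow_succ, mul_smul, ← hy1]; exact ih
  have hMy : (2 : ℤ) ^ M • y = 0 := by
    rw [hy, smul_smul, mul_comm, ← smul_smul, hM, smul_zero]
  rw [hyj M, show (-(2 * (d : ℤ))) ^ M = (-(d : ℤ)) ^ M * 2 ^ M by rw [← mul_pow]; ring,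
    mul_smul, hMy, smul_zero]

/-! ### The inflation defect at finite index, from Serre's open image theorem -/

/-- **Bounded inflation defect at finite `2`-adic index (uniform in the level).** For non-CM
`E = W/ℚ` and a quadratic field `K` there is `k` such that for all `M ≤ M'` every class
`x ∈ H¹(K, E[2^M])` vanishing on `Γ_{K(E[2^{M'}])}` satisfies `2^k x = 0` — i.e. `2^k` kills
`H¹(K(E[2^{M'}])/K, E[2^M])` for ALL `M ≤ M'`. This is hypothesis `hSah` of
`exists_kolyvaginPrime_gt_two_eigenclass_of_inflationDefect` with a `k` INDEPENDENT of `M, M'`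
(`k = n + 3`, `2^n` the level of the `2`-adic image), the bet of item 27123's `why it might fail`.
Conditional only on the named fact `serre_adicImage_contains_congruenceSubgroup` (in print).
[cite: SilvermanAEC2009, Thm. III.7.9 (a)] [cite: Sah1968, Prop. 2.7 (b)]
[cite: Kolyvagin1991MathAnn, §2] -/
theorem inflationDefect_of_serre (hSerre : serre_adicImage_contains_congruenceSubgroup)
    (W : WeierstrassCurve ℚ) [W.IsElliptic] (hCM : ¬ W.HasCM) (K : Type u) [Field K]
    [NumberField K] (hK : Module.finrank ℚ K = 2) :
    ∃ k : ℕ, ∀ (M M' : ℕ), M ≤ M' → ∀ x : galH1Torsion (W.baseChange K) ((2 ^ M : ℕ) : ℤ),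
      (∀ g ∈ torsionFixing (W.baseChange K) ((2 ^ M' : ℕ) : ℤ),
        h1Eval (W.baseChange K) ((2 ^ M : ℕ) : ℤ) x g = 0) → (2 : ℤ) ^ k • x = 0 := by
  obtain ⟨n, σ, hσ⟩ := exists_smul_eq_natCast_smul_of_serre hSerre W hCM
  refine ⟨n + 3, fun M M' hMM' x hx ↦ ?_⟩
  have hdvd : ((2 ^ M : ℕ) : ℤ) ∣ ((2 ^ M' : ℕ) : ℤ) := by exact_mod_cast Nat.pow_dvd_pow 2 hMM'
  obtain ⟨g, hg⟩ := exists_smul_eq_mul_self_zsmul_baseChange W hK (hσ M')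
  have hSah := sub_one_zsmul_eq_zero_of_h1Eval_eq_zero_of_smul_eq (W.baseChange K) hdvd hg hx
  -- `(1 + 2^{n+2})² - 1 = 2^{n+3} (2·2^n + 1)`
  have e : ((1 + 2 ^ (n + 2) : ℕ) : ℤ) * ((1 + 2 ^ (n + 2) : ℕ) : ℤ) - 1 =
      (2 : ℤ) ^ (n + 3) * (2 * (2 ^ n : ℕ) + 1) := by push_cast; ring
  rw [e] at hSah
  have hM : (2 : ℤ) ^ M • x = 0 := by
    have := zsmul_galH1Torsion_eq_zero _ _ x
    exact_mod_cast this
  exact pow_zsmul_eq_zero_of_mul_odd_zsmul_eq_zero hSah hM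

end Summit.BirchSwinnertonDyer.BirchSwinnertonDyer.Theorems.KolyvaginLowerBoundAtTwo

end
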